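import Literature.Geometry.Lorentzian.KerrDeSitterMasterEquations
import HarnessLib

/-!
# Venture KdS — the MASSLESS scalar (`s = 0`, `μ = 0`) truncated mode-stability statement on a box

HONEST FRAMING (venture `Summits/Ventures/KdS`, cell `pub-kds`): statement shapes and reduction glue
only; no claim about the Final State Conjecture or about untruncated mode stability. Casals–Teixeira
da Costa 2022, Thm 3.10 is printed for the Klein–Gordon parameter `μ = 1` (their radial equation
(3.9) has `r = ∞` as an ordinary point only then); for the massless wave equation `□_g ψ = 0`
(`s = 0`, `μ = 0`, CTdC (3.6)/(3.8) at `μ = 0`) the cell's confinement lemma L-CONF0 (cell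
theory/CONFINEMENT.md §3, obtained on paper from the radial energy identity of CTdC's proof of
Thm 3.10, Step 1) confines every growing mode: `‖ω‖² < m² ϖ₁² + 2Λ/(3Ξ³)` (`ϖ₁ = a/(r₊² + a²)`).
It is a HYPOTHESIS here (`LConf0`), to be proved in a sibling file. The census windows are the
squares `W₀(m) = {|Re ω| ≤ R0 m, 0 < Im ω ≤ R0 m}` with `(R0 m)² ≥ sup_B (m² ϖ₁² + 2Λ/(3Ξ³))`
(H4₀), INCLUDING `m = 0`. Modes are the master-system modes `IsMasterModeSolution M a Λ 0 0 ω m λ̄ R`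
of `Literature/Geometry/Lorentzian/KerrDeSitterMasterEquations.lean` (CTdC (3.6)/(3.8) with the
Klein–Gordon switch `μ`); the λ-sets are sets of CTdC's `λ̄`. Strictly growing modes only.

Contents: `NoMasterModeWith`, `conf0Sq`, `LConf0`, `window0`/regions, `WindowConstants0`,
`StatementA0/B0`, `MSTrunc0`, the coverage theorem `statementA0_of` (PROVED) and
`msTrunc0_of_facts` (PROVED); the B0 square table `R0B0` (`3/20, 1/5, 1/3` for `|m| = 0, 1, 2`,
cell CENSUS-SPEC note 2026-08-22T07:04Z; the box `B0` is defined in `ModeStability.lean`). Source of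
the shapes: cell HOME
`run/shared/lean/pub/pub-kds/theory/MasslessScalar_v1.sketch.lean` (lead seat), CONFINEMENT.md.

References: M. Casals, R. Teixeira da Costa, Commun. Math. Phys. 394 (2022) 797–832
[CasalsTeixeiradacosta2022], (3.6), (3.8), Def. 3.4, proof of Thm 3.10 (Step 1).
-/

noncomputable section

open Set Complex

namespace Summit.Ventures.KdS

open Literature.Geometry.Lorentzian Literature.Geometry.Lorentzian.KerrDeSitter

/-- λ̄-truncated "no master mode": no master-system mode with `(ω, m) ∈ W` and `λ̄ ∈ Λs ω m`. -/
def NoMasterModeWith (M a Λ s μ : ℝ) (W : Set (ℂ × ℝ)) (Λs : ℂ → ℝ → Set ℂ) : Prop :=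
  ∀ ω : ℂ, ∀ m : ℝ, (ω, m) ∈ W → (∃ k : ℤ, m - s = k) →
    ∀ lamBar ∈ Λs ω m, ∀ R : ℝ → ℂ, ¬IsMasterModeSolution M a Λ s μ ω m lamBar R

/-- With the trivial λ̄-family `NoMasterModeWith` is `NoMasterModeIn`. -/
theorem noMasterModeWith_univ_iff (M a Λ s μ : ℝ) (W : Set (ℂ × ℝ)) :
    NoMasterModeWith M a Λ s μ W (fun _ _ => univ) ↔ NoMasterModeIn M a Λ s μ W := by
  unfold NoMasterModeWith NoMasterModeIn HasMasterMode
  constructor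
  · intro h ω m hW hk ⟨lam, R, hR⟩
    exact h ω m hW hk lam (mem_univ _) R hR
  · intro h ω m hW hk lam _ R hR
    exact h ω m hW hk ⟨lam, R, hR⟩

/-- The confinement radius squared of L-CONF0: `C₀'(m)² = m² ϖ₁² + 2Λ/(3Ξ³)` (cell
theory/CONFINEMENT.md §3, the crude constant). -/
def conf0Sq (M a Λ : ℝ) (m : ℝ) : ℝ :=
  m ^ 2 * (horizonAngVel a (rPlus M a Λ)) ^ 2 + 2 * Λ / (3 * (xi a Λ) ^ 3)

/-- L-CONF0 on the box `B` (HYPOTHESIS; cell theory/CONFINEMENT.md §3, from the radial energy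
identity of Casals–Teixeira da Costa's proof of Thm 3.10, Step 1, at `μ = 0`): every growing
massless-scalar mode has `‖ω‖² < C₀'(m)²`. -/
def LConf0 (B : Set (ℝ × ℝ × ℝ)) : Prop :=
  ∀ p ∈ B, ∀ (ω : ℂ) (m : ℝ), (∃ k : ℤ, m = k) → 0 < ω.im →
    HasMasterMode p.1 p.2.1 p.2.2 0 0 ω m → ‖ω‖ ^ 2 < conf0Sq p.1 p.2.1 p.2.2 m

/-- The μ = 0 census window (upper-half-plane part): the square `|Re ω| ≤ R0 m`, `0 < Im ω ≤ R0 m`. -/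
def window0 (R0 : ℝ → ℝ) (m : ℝ) : Set ℂ := {ω | |ω.re| ≤ R0 m ∧ 0 < ω.im ∧ ω.im ≤ R0 m}

/-- Region A₀: `Im ω > 0`, `|m| ≤ M0`, `ω` outside the square window. -/
def regionPrint0 (M0 : ℝ) (R0 : ℝ → ℝ) : Set (ℂ × ℝ) :=
  {q | 0 < q.1.im ∧ |q.2| ≤ M0 ∧ q.1 ∉ window0 R0 q.2}

/-- Region B₀: `Im ω > 0`, `|m| ≤ M0`, `ω` inside the square window. -/
def regionCert0 (M0 : ℝ) (R0 : ℝ → ℝ) : Set (ℂ × ℝ) :=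
  {q | 0 < q.1.im ∧ |q.2| ≤ M0 ∧ q.1 ∈ window0 R0 q.2}

/-- (H4₀) μ = 0 WINDOW CONSTANTS of the box: `0 ≤ R0 m` and `C₀'(m)² ≤ (R0 m)²` for `|m| ≤ M0`
(enclosures of `ϖ₁`, `Ξ` over `B`; two engines). -/
def WindowConstants0 (B : Set (ℝ × ℝ × ℝ)) (M0 : ℝ) (R0 : ℝ → ℝ) : Prop :=
  ∀ p ∈ B, ∀ m : ℝ, |m| ≤ M0 → 0 ≤ R0 m ∧ conf0Sq p.1 p.2.1 p.2.2 m ≤ (R0 m) ^ 2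

/-- STATEMENT A₀: off the square windows there is no growing massless-scalar mode, `|m| ≤ M0`. -/
def StatementA0 (B : Set (ℝ × ℝ × ℝ)) (M0 : ℝ) (R0 : ℝ → ℝ) : Prop :=
  ∀ p ∈ B, NoMasterModeIn p.1 p.2.1 p.2.2 0 0 (regionPrint0 M0 R0)

/-- STATEMENT B₀ (certificates, runs 4–6 incl. CERT_0 for m = 0): inside the windows, no growing
mode with `λ̄ ∈ Λs`. -/
def StatementB0 (B : Set (ℝ × ℝ × ℝ)) (M0 : ℝ) (R0 : ℝ → ℝ) (Λs : ℝ → ℝ → ℂ → ℝ → Set ℂ) :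
    Prop :=
  ∀ p ∈ B, NoMasterModeWith p.1 p.2.1 p.2.2 0 0 (regionCert0 M0 R0) (Λs p.2.1 p.2.2)

/-- MS_trunc(B; s = 0, μ = 0, M0, Λs), strictly growing modes only. -/
def MSTrunc0 (B : Set (ℝ × ℝ × ℝ)) (M0 : ℝ) (R0 : ℝ → ℝ) (Λs : ℝ → ℝ → ℂ → ℝ → Set ℂ) : Prop :=
  ∀ p ∈ B, NoMasterModeWith p.1 p.2.1 p.2.2 0 0 {q | 0 < q.1.im ∧ |q.2| ≤ M0}
    (fun ω m => {lam | ω ∈ window0 R0 m → lam ∈ Λs p.2.1 p.2.2 ω m})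

/-- Statement A₀ and Statement B₀ give MS_trunc₀. -/
theorem msTrunc0_of {B : Set (ℝ × ℝ × ℝ)} {M0 : ℝ} {R0 : ℝ → ℝ} {Λs : ℝ → ℝ → ℂ → ℝ → Set ℂ}
    (hA : StatementA0 B M0 R0) (hB : StatementB0 B M0 R0 Λs) : MSTrunc0 B M0 R0 Λs := by
  intro p hp ω m hq hk lam hlam R hR
  obtain ⟨him, hm⟩ := hq
  by_cases hw : ω ∈ window0 R0 m
  · exact hB p hp ω m ⟨him, hm, hw⟩ hk lam (hlam hw) R hR
  · exact hA p hp ω m ⟨him, hm, hw⟩ hk ⟨lam, R, hR⟩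

/-- COVERAGE₀: Statement A₀ from L-CONF0 and (H4₀): outside the square, `‖ω‖ > R0 m ≥ C₀'(m)`. -/
theorem statementA0_of {B : Set (ℝ × ℝ × ℝ)} {M0 : ℝ} {R0 : ℝ → ℝ}
    (hconf : LConf0 B) (h4 : WindowConstants0 B M0 R0) : StatementA0 B M0 R0 := by
  intro p hp ω m hq hk hmode
  obtain ⟨hIm, hm2, hnotW⟩ := hq
  obtain ⟨hR0, hC⟩ := h4 p hp m hm2
  have hk' : ∃ k : ℤ, m = k := by
    obtain ⟨k, hk⟩ := hk
    exact ⟨k, by simpa using hk⟩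
  have hlt := hconf p hp ω m hk' hIm hmode
  -- outside the square: |Re ω| > R0 m or Im ω > R0 m, hence ‖ω‖ > R0 m
  have hbig : R0 m < ‖ω‖ := by
    by_cases hre : |ω.re| ≤ R0 m
    · have hgt : R0 m < ω.im := by
        by_contra hle
        exact hnotW ⟨hre, hIm, not_lt.mp hle⟩
      calc R0 m < ω.im := hgt
        _ ≤ |ω.im| := le_abs_self _
        _ ≤ ‖ω‖ := Complex.abs_im_le_norm ω
    · calc R0 m < |ω.re| := not_le.mp hre
        _ ≤ ‖ω‖ := Complex.abs_re_le_norm ω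
  have hsq : (R0 m) ^ 2 < ‖ω‖ ^ 2 := by
    have := hbig
    nlinarith [norm_nonneg ω]
  linarith

/-- The theorem shape for `μ = 0`: MS_trunc₀ from L-CONF0, (H4₀) and the certificates' Statement B₀. -/
theorem msTrunc0_of_facts {B : Set (ℝ × ℝ × ℝ)} {M0 : ℝ} {R0 : ℝ → ℝ}
    {Λs : ℝ → ℝ → ℂ → ℝ → Set ℂ}
    (hconf : LConf0 B) (h4 : WindowConstants0 B M0 R0) (hB : StatementB0 B M0 R0 Λs) :
    MSTrunc0 B M0 R0 Λs :=
  msTrunc0_of (statementA0_of hconf h4) hB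


/-! ### The B0 square table (cell CENSUS-SPEC note 2026-08-22T07:04Z: half-sizes
`R0(m) = 3/20, 1/5, 1/3` for `|m| = 0, 1, 2`, which dominate `(9/8)·C₀'(m; B0)`; the box `B0` itself
is `Summit.Ventures.KdS.B0` of `ModeStability.lean`, and `WindowConstants0 B0 2 R0B0` is rung R2₀) -/

/-- The μ = 0 square-window table of the pilot box B0: `R0 0 = 3/20`, `R0 (±1) = 1/5`,
`R0 (±2) = 1/3`. -/
def R0B0 (m : ℝ) : ℝ := if m = 0 then 3/20 else if |m| = 1 then 1/5 else 1/3

end Summit.Ventures.KdS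

end
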